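import Literature.AnabelianGeometry.EtaleTheta.Discharge.Sec5OfThetaSetting

/-!
# [EtTh] Lemma 5.8 / 5.9 (iv): the `K^×`-part `DK` of `D ⊆ Out(E^Π_N)` PINNED at the genuine §5 data over `B^temp(Π^tp_X)⁰` and at the §5 data
# OF THE SETTING — `DK := Im((K^×)^{1/N} → Out(E^Π_N))` by the Kummer cocycles of the birational constants (pp.331–332 / PDF pp.105–106)

Mochizuki, *The étale theta function …*, Publ. RIMS **45** (2009), Lemma 5.8 p.331 (PDF p.105): "we have a natural outer action of
`(O_K^×)^{1/N}/μ_N(B_N) (⥲ O_K^×)` on `E_N`; this outer action extends to an outer action of `(K^×)^{1/N}/μ_N(B_N) (⥲ K^×)` on `E_N`";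
Lemma 5.9 (iv) p.332 (PDF p.106): "the subgroup of `Out(E^Π_N)` generated by the natural outer actions of `l·ℤ`, `K^×` on `E_N`".
[cite: MochizukiEtTh2009, Lem 5.8 p.331 (PDF p.105); Lem 5.9 (iv) p.332 (PDF p.106)]

abc-iut cell, layer L2, seat abc-iut-L2-t4 (§5 owner, gen 4), ROW W3-L2-01 «§5 GENUINE DATA», MERGE-PLAN row 11 (the parameter `DK` of
`FrobenioidMonoThetaEnv.lean`, finding F1: "the `K^×`-part of `D` … needs the birationalization `Aut_{C^birat}(B_N^birat)`, which the §5 data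
stub does not carry").  CLASS (b) construction file (the PIN = two `def`s per level + `rfl`s); nothing landed is edited.  COMPOSITION BY NAME of
* abc-iut-L2-t11's constructor `ThetaFrobenioid.BiratAutAction.kummerOut hK` (`FrobenioidKummerOut.lean`: "conjugation by `f ∈ (K^×)^{1/N}`" on
  `E^Π_N` = the Kummer-cocycle twist `(e, y) ↦ (κ_f(e)⁻¹ · e, y)`, bi-continuous; `kummerOut := Im((K^×)^{1/N} → Out(E^Π_N))`), over its
  hypothesis structure `BiratAutAction` (the action of `Aut_C(B_N)` on `O^×(B_N^birat)`) and abc-iut-L2-t4's named clause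
  `KxRootNModCyclotome` (Lemma 5.8: "`(K^×)^{1/N}/μ_N(B_N) ⥲ K^×`" — `N`-th power onto the constants, kernel `μ_N(B_N)`);
* gen 3's instantiation `biratAutAction_ofConnectedTemperoidData hconst` of that structure at the GENUINE §5 data over `B^temp(Π^tp_X)⁰`
  (`Discharge/Sec5OfConnectedTemperoid.lean`, p427614: `act := biratAutModel` of abc-iut-L2-t9, i.e. `B(Base(e⁻¹))^*`; input `hconst` = Def. 3.6 (iii),
  GAP G-L2t4-3, discharged for the terminal-object shape of the constants by abc-iut-w4-d008's p431786).
RESULTS: `ThetaFrobenioid.dkOfConnectedTemperoidData hconst hK` / `dkOfThetaSettingData … hconst hK` — **the honest `DK`** of the genuine data /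
of the Setting; `monoThetaEnvOfConnectedTemperoidData hH hconst hgc hK` / `monoThetaEnvOfThetaSettingYddData hconst hgc hK` — **the
Frobenioid-theoretic mono-theta environment `𝕄(𝔉)` of Lemma 5.9 (iv) / Rmk. 5.10.1 with `D := ⟨galOut ∪ constOut ∪ DK⟩` for THIS `DK`**
(abc-iut-L2-t4's `monoThetaEnvOf`), inputs `{hH (a theorem for A_⊙^bs := Ÿ̲̲), hconst, hgc, hK}` — so Lemma 5.9 (iv)'s `FrdIsMonoThetaEnv` /
Thm. 5.10 (iii)'s `MonoThetaEnvCompat` and abc-iut-L2-t11's `KummerOutReached … DK …` can now be read at the HONEST `DK` instead of `DK := ∅` or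
the canonical preimage `DK₀` (`Discharge/Sec5KummerOutCanonical.lean`); the comparison `transport(DK) ⊆ T.kummerOut` is abc-iut-L2-t11's
`Sec5KummerOutTransport` / `Sec5ConstantsKummer` pattern (hypothesis `hinfl`: the Kummer cocycle of a constant is inflated from `G_K`).
HONEST FRAMING: definitions by composition of typed interfaces; `hconst`, `hgc`, `hK` remain printed inputs; `tf` is NOT shown inhabited for the
curve; nothing here takes a side on [IUTchIII] Cor. 3.12; typed ≠ proved.
-/

noncomputable section

namespace Literature.AnabelianGeometry.EtaleTheta

open CategoryTheory Opposite Literature.AlgebraicGeometry.Frobenioids Literature.AnabelianGeometry.SemiGraphs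
  Literature.AnabelianGeometry.SemiGraphs.GaloisObjects Literature.AlgebraicGeometry.Frobenioids.QuasiTemperoid.BTempConnected

universe u₀ v₀ w

namespace ThetaFrobenioid

/-! ### At the genuine §5 data over `B^temp(Π^tp_X)⁰` (any `X`, `T`, `ιX`) -/

section Connected

variable {K : Type u₀} [Field K] {X : SemiGraphs.TemperedArithmeticGroup.{u₀} K} {D₀ : Type u₀} [Category.{v₀} D₀]
  {V : FrdIMonoidStub.{w}} {T₀ : RealifiedDivisorMonoids (D₀ := D₀) V}
  {VD : FrdICatStub.{u₀ + 1, u₀, w} (ConnectedPart (BTemp X.Pi))}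
  {tf : TemperedFrobenioid T₀ (ConnectedPart (BTemp X.Pi)) VD} {hZ : tf.monoidType = MonoidType.Z}
  {hP : ∀ A : (ConnectedPart (BTemp X.Pi))ᵒᵖ, IsPerfect (tf.Φ.carrier A)}
  {NH : Subgroup (Field.absoluteGaloisGroup K) → tf.category → ℕ+ → Prop} {A₀ : tf.category}
  {hA₀ : PreFrobenioid.IsFrobeniusTrivial tf.toElem A₀} {hA₀' : SemiGraphs.IsGaloisObj A₀.base.obj}
  {pullFrac : ∀ {A A' : (BiKummerSetting.mkOfConnectedTemperoid X tf hZ hP NH A₀ hA₀ hA₀').C} (_ : A' ⟶ A),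
    (BiKummerSetting.mkOfConnectedTemperoid X tf hZ hP NH A₀ hA₀ hA₀').biratUnits A →
      (BiKummerSetting.mkOfConnectedTemperoid X tf hZ hP NH A₀ hA₀ hA₀').biratUnits A'}
  {lv N : ℕ+} {T : ThetaEnvData.{max u₀ w} N}
  {θ : (BiKummerSetting.mkOfConnectedTemperoid X tf hZ hP NH A₀ hA₀ hA₀').biratUnits
    (BiKummerSetting.mkOfConnectedTemperoid X tf hZ hP NH A₀ hA₀ hA₀').Aodot}
  {Bl : (BiKummerSetting.mkOfConnectedTemperoid X tf hZ hP NH A₀ hA₀ hA₀').C}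
  {Pl : (BiKummerSetting.mkOfConnectedTemperoid X tf hZ hP NH A₀ hA₀ hA₀').FractionPair θ Bl}
  {Rl : (BiKummerSetting.mkOfConnectedTemperoid X tf hZ hP NH A₀ hA₀ hA₀').NthRoot θ Pl lv pullFrac}
  (h : ModelFrobenioid.Hypotheses tf.divisorMonoid tf.ratFnFunctor)
  (Q : FrobenioidTheta.ThetaSubquotientStub.{w} (ConnectedPart (BTemp X.Pi))) (odd_l : Odd (lv : ℕ))
  (R : (BiKummerSetting.mkOfConnectedTemperoid X tf hZ hP NH A₀ hA₀ hA₀').NthRoot Rl.root Rl.pair N pullFrac)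
  (ιX : T.PiX ≃ₜ* X.Pi) (K' : Type w) [Field K'] (constEmb : K'ˣ →* tf.biratUnitsModel R.BN)
  (constEmb_injective : Function.Injective constEmb)
  (hinvc : ∀ g : Aut R.AN.base,
    pull tf.divisorMonoid g.hom (ModelFrobenioid.div R.pair.num) = ModelFrobenioid.div R.pair.num)
  (hinvp : ∀ y : T.PiX, y ∈ T.PiYdd →
    pull tf.divisorMonoid ((BiKummerSetting.mkOfConnectedTemperoid X tf hZ hP NH A₀ hA₀ hA₀').galoisSurj R.AN.base
      R.αData.isGalois (ιX y)).hom (ModelFrobenioid.div R.pair.den) = ModelFrobenioid.div R.pair.den)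
  (hconst : ∀ (e : Aut R.BN) (k : K'ˣ), tf.biratAutModel R.BN e (constEmb k) = constEmb k)
  (hK : (ofConnectedTemperoidData h Q odd_l R ιX K' constEmb constEmb_injective hinvc hinvp).KxRootNModCyclotome)

/-- **The honest `K^×`-part `DK ⊆ Out(E^Π_N)` of the genuine §5 data over `B^temp(Π^tp_X)⁰`** (Lemma 5.8 "extends to an outer action of
`(K^×)^{1/N}/μ_N(B_N) ⥲ K^×`"): abc-iut-L2-t11's `kummerOut` — the outer automorphisms of `E^Π_N` given by the Kummer cocycles
`κ_f(e) = (e·f)·f⁻¹ ∈ μ_N(B_N)` of the `N`-th roots `f ∈ (K^×)^{1/N} ⊆ O^×(B_N^birat)` of the constants — for the birational action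
`biratAutAction_ofConnectedTemperoidData hconst` (`B(Base(e⁻¹))^*`).  [cite: MochizukiEtTh2009, Lem 5.8 p.331 (PDF p.105); Lem 5.9 (iv) p.332 (PDF p.106)] -/
def dkOfConnectedTemperoidData :
    Set (TopOut (ofConnectedTemperoidData h Q odd_l R ιX K' constEmb constEmb_injective hinvc hinvp).EPiN) :=
  (biratAutAction_ofConnectedTemperoidData h Q odd_l R ιX K' constEmb constEmb_injective hinvc hinvp hconst).kummerOut hK

/-- Unfolding (definitional). [cite: MochizukiEtTh2009, Lem 5.8 p.331 (PDF p.105)] -/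
theorem dkOfConnectedTemperoidData_eq :
    dkOfConnectedTemperoidData h Q odd_l R ιX K' constEmb constEmb_injective hinvc hinvp hconst hK =
      (biratAutAction_ofConnectedTemperoidData h Q odd_l R ιX K' constEmb constEmb_injective hinvc hinvp hconst).kummerOut hK := rfl

/-- Membership: `o ∈ DK ↔ o` is the Kummer outer automorphism of some `f ∈ (K^×)^{1/N}` (abc-iut-L2-t11's `mem_kummerOut_iff`).
[cite: MochizukiEtTh2009, Lem 5.8 p.331 (PDF p.105)] -/
theorem mem_dkOfConnectedTemperoidData_iff
    (o : TopOut (ofConnectedTemperoidData h Q odd_l R ιX K' constEmb constEmb_injective hinvc hinvp).EPiN) :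
    o ∈ dkOfConnectedTemperoidData h Q odd_l R ιX K' constEmb constEmb_injective hinvc hinvp hconst hK ↔
      ∃ f, (biratAutAction_ofConnectedTemperoidData h Q odd_l R ιX K' constEmb constEmb_injective hinvc hinvp hconst).kummerOutHom
        hK f = o :=
  Set.mem_range

/-- **The Frobenioid-theoretic mono-theta environment `𝕄(𝔉)` of the genuine §5 data over `B^temp(Π^tp_X)⁰` with the honest `DK`**
(Lemma 5.9 (iv) "In particular"; Rmk. 5.10.1 "a mono-theta environment may be 'extracted' from the tempered Frobenioids … in a purely
category-theoretic fashion"): abc-iut-L2-t4's `monoThetaEnvOf` at `Facts := facts_ofConnectedTemperoidData hH hconst hgc` and `DK := dkOf…`;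
inputs `{hH, hconst, hgc, hK}`.  [cite: MochizukiEtTh2009, Lem 5.9 (iv) p.332 (PDF p.106); Rmk 5.10.1 p.335 (PDF p.109)] -/
def monoThetaEnvOfConnectedTemperoidData
    (hH : ∀ y : T.PiX, y ∈ T.PiYdd → ιX y ∈ (BiKummerSetting.mkOfConnectedTemperoid X tf hZ hP NH A₀ hA₀ hA₀').Hodot)
    (hgc : ∀ u : (ofConnectedTemperoidData h Q odd_l R ιX K' constEmb constEmb_injective hinvc hinvp).units
        (ofConnectedTemperoidData h Q odd_l R ιX K' constEmb constEmb_injective hinvc hinvp).BN,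
      (∀ y ∈ (ofConnectedTemperoidData h Q odd_l R ιX K' constEmb constEmb_injective hinvc hinvp).imPiY,
        (ofConnectedTemperoidData h Q odd_l R ιX K' constEmb constEmb_injective hinvc hinvp).sgpCap y *
          (u : Aut (ofConnectedTemperoidData h Q odd_l R ιX K' constEmb constEmb_injective hinvc hinvp).BN) *
          ((ofConnectedTemperoidData h Q odd_l R ιX K' constEmb constEmb_injective hinvc hinvp).sgpCap y)⁻¹ = u) →
      (ofConnectedTemperoidData h Q odd_l R ιX K' constEmb constEmb_injective hinvc hinvp).unitsToBirat
          (ofConnectedTemperoidData h Q odd_l R ιX K' constEmb constEmb_injective hinvc hinvp).BN u ∈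
        (ofConnectedTemperoidData h Q odd_l R ιX K' constEmb constEmb_injective hinvc hinvp).constEmb.range) :
    MonoThetaEnv :=
  (ofConnectedTemperoidData h Q odd_l R ιX K' constEmb constEmb_injective hinvc hinvp).monoThetaEnvOf
    (facts_ofConnectedTemperoidData h Q odd_l R ιX K' constEmb constEmb_injective hinvc hinvp hH hconst hgc)
    (dkOfConnectedTemperoidData h Q odd_l R ιX K' constEmb constEmb_injective hinvc hinvp hconst hK)

end Connected

/-! ### At the §5 data OF THE SETTING -/

section Setting

variable {p : ℕ} [Fact p.Prime] {D : ThetaSetting p} {E : D.EtaleThetaData} {l : ℕ} {C : E.DoubleUnderline l}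
  {e : D.toTemperedCurve.GroupLevelData} {N : ℕ+} (μ : D.CyclotomeMod l N) (hC : D.Compat) (hS : D.Sec2Hyps)
  {D₀ : Type} [Category.{v₀} D₀] {V : FrdIMonoidStub.{0}} {T₀ : RealifiedDivisorMonoids (D₀ := D₀) V}
  {VD : FrdICatStub.{1, 0, 0} (ConnectedPart (BTemp (C.temperedArithmeticGroup e).Pi))}
  {tf : TemperedFrobenioid T₀ (ConnectedPart (BTemp (C.temperedArithmeticGroup e).Pi)) VD} {hZ : tf.monoidType = MonoidType.Z}
  {hP : ∀ A : (ConnectedPart (BTemp (C.temperedArithmeticGroup e).Pi))ᵒᵖ, IsPerfect (tf.Φ.carrier A)}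
  {NH : Subgroup (Field.absoluteGaloisGroup D.K) → tf.category → ℕ+ → Prop}
  {pullFrac : ∀ {A A' : (BiKummerSetting.mkOfThetaSettingYdd C e μ hC hS tf hZ hP NH).C} (_ : A' ⟶ A),
    (BiKummerSetting.mkOfThetaSettingYdd C e μ hC hS tf hZ hP NH).biratUnits A →
      (BiKummerSetting.mkOfThetaSettingYdd C e μ hC hS tf hZ hP NH).biratUnits A'}
  {θ : (BiKummerSetting.mkOfThetaSettingYdd C e μ hC hS tf hZ hP NH).biratUnits (BiKummerSetting.mkOfThetaSettingYdd C e μ hC hS tf hZ hP NH).Aodot}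
  {Bl : (BiKummerSetting.mkOfThetaSettingYdd C e μ hC hS tf hZ hP NH).C}
  {Pl : (BiKummerSetting.mkOfThetaSettingYdd C e μ hC hS tf hZ hP NH).FractionPair θ Bl}
  {Rl : (BiKummerSetting.mkOfThetaSettingYdd C e μ hC hS tf hZ hP NH).NthRoot θ Pl C.lPNat pullFrac}
  (h : ModelFrobenioid.Hypotheses tf.divisorMonoid tf.ratFnFunctor)
  (Q : FrobenioidTheta.ThetaSubquotientStub.{0} (ConnectedPart (BTemp (C.temperedArithmeticGroup e).Pi)))
  (R : (BiKummerSetting.mkOfThetaSettingYdd C e μ hC hS tf hZ hP NH).NthRoot Rl.root Rl.pair N pullFrac)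
  (K' : Type) [Field K'] (constEmb : K'ˣ →* tf.biratUnitsModel R.BN) (constEmb_injective : Function.Injective constEmb)
  (hinvc : ∀ g : Aut R.AN.base,
    pull tf.divisorMonoid g.hom (ModelFrobenioid.div R.pair.num) = ModelFrobenioid.div R.pair.num)
  (hinvp : ∀ y : (C.thetaEnvData μ hC hS).PiX, y ∈ (C.thetaEnvData μ hC hS).PiYdd →
    pull tf.divisorMonoid ((BiKummerSetting.mkOfThetaSettingYdd C e μ hC hS tf hZ hP NH).galoisSurj
      R.AN.base R.αData.isGalois ((ContinuousMulEquiv.refl _) y)).hom (ModelFrobenioid.div R.pair.den) = ModelFrobenioid.div R.pair.den)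
  (hconst : ∀ (ε : Aut R.BN) (k : K'ˣ), tf.biratAutModel R.BN ε (constEmb k) = constEmb k)
  (hK : (ofThetaSettingData μ hC hS h Q R K' constEmb constEmb_injective hinvc hinvp).KxRootNModCyclotome)

/-- **The honest `DK` of the §5 data OF THE SETTING** (`A_⊙^bs := Ÿ̲̲`): `dkOfConnectedTemperoidData` at `(X, T, ιX) := (Π^tp_X̲̲, C.thetaEnvData μ hC hS, id)`.
[cite: MochizukiEtTh2009, Lem 5.8 p.331 (PDF p.105); Lem 5.9 (iv) p.332 (PDF p.106)] -/
def dkOfThetaSettingData : Set (TopOut (ofThetaSettingData μ hC hS h Q R K' constEmb constEmb_injective hinvc hinvp).EPiN) :=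
  dkOfConnectedTemperoidData (T := C.thetaEnvData μ hC hS) h Q C.odd_lPNat R (ContinuousMulEquiv.refl _) K' constEmb
    constEmb_injective hinvc hinvp hconst hK

/-- Unfolding (definitional). [cite: MochizukiEtTh2009, Lem 5.8 p.331 (PDF p.105)] -/
theorem dkOfThetaSettingData_eq :
    dkOfThetaSettingData μ hC hS h Q R K' constEmb constEmb_injective hinvc hinvp hconst hK =
      (biratAutAction_ofConnectedTemperoidData (T := C.thetaEnvData μ hC hS) h Q C.odd_lPNat R (ContinuousMulEquiv.refl _) K'
        constEmb constEmb_injective hinvc hinvp hconst).kummerOut hK := rfl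

/-- **`𝕄(𝔉)` of the §5 data OF THE SETTING with the honest `DK`**, `hH` DISCHARGED (`A_⊙^bs := Ÿ̲̲`): inputs `{hconst, hgc, hK}` and the data.
[cite: MochizukiEtTh2009, Lem 5.9 (iv) p.332 (PDF p.106); Rmk 5.10.1 p.335 (PDF p.109)] -/
def monoThetaEnvOfThetaSettingYddData
    (hgc : ∀ u : (ofThetaSettingData μ hC hS h Q R K' constEmb constEmb_injective hinvc hinvp).units
        (ofThetaSettingData μ hC hS h Q R K' constEmb constEmb_injective hinvc hinvp).BN,
      (∀ y ∈ (ofThetaSettingData μ hC hS h Q R K' constEmb constEmb_injective hinvc hinvp).imPiY,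
        (ofThetaSettingData μ hC hS h Q R K' constEmb constEmb_injective hinvc hinvp).sgpCap y *
          (u : Aut (ofThetaSettingData μ hC hS h Q R K' constEmb constEmb_injective hinvc hinvp).BN) *
          ((ofThetaSettingData μ hC hS h Q R K' constEmb constEmb_injective hinvc hinvp).sgpCap y)⁻¹ = u) →
      (ofThetaSettingData μ hC hS h Q R K' constEmb constEmb_injective hinvc hinvp).unitsToBirat
          (ofThetaSettingData μ hC hS h Q R K' constEmb constEmb_injective hinvc hinvp).BN u ∈
        (ofThetaSettingData μ hC hS h Q R K' constEmb constEmb_injective hinvc hinvp).constEmb.range) :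
    MonoThetaEnv :=
  monoThetaEnvOfConnectedTemperoidData (T := C.thetaEnvData μ hC hS) h Q C.odd_lPNat R (ContinuousMulEquiv.refl _) K' constEmb
    constEmb_injective hinvc hinvp hconst hK (BiKummerSetting.hH_mkOfThetaSettingYdd C e μ hC hS tf hZ hP NH) hgc

/-- Unfolding: `𝕄(𝔉)` of the Setting IS `monoThetaEnvOf` at `Facts := facts_ofThetaSettingYddData hconst hgc`, `DK := dkOfThetaSettingData` (definitional).
[cite: MochizukiEtTh2009, Rmk 5.10.1 p.335 (PDF p.109)] -/
theorem monoThetaEnvOfThetaSettingYddData_eq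
    (hgc : ∀ u : (ofThetaSettingData μ hC hS h Q R K' constEmb constEmb_injective hinvc hinvp).units
        (ofThetaSettingData μ hC hS h Q R K' constEmb constEmb_injective hinvc hinvp).BN,
      (∀ y ∈ (ofThetaSettingData μ hC hS h Q R K' constEmb constEmb_injective hinvc hinvp).imPiY,
        (ofThetaSettingData μ hC hS h Q R K' constEmb constEmb_injective hinvc hinvp).sgpCap y *
          (u : Aut (ofThetaSettingData μ hC hS h Q R K' constEmb constEmb_injective hinvc hinvp).BN) *
          ((ofThetaSettingData μ hC hS h Q R K' constEmb constEmb_injective hinvc hinvp).sgpCap y)⁻¹ = u) →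
      (ofThetaSettingData μ hC hS h Q R K' constEmb constEmb_injective hinvc hinvp).unitsToBirat
          (ofThetaSettingData μ hC hS h Q R K' constEmb constEmb_injective hinvc hinvp).BN u ∈
        (ofThetaSettingData μ hC hS h Q R K' constEmb constEmb_injective hinvc hinvp).constEmb.range) :
    monoThetaEnvOfThetaSettingYddData μ hC hS h Q R K' constEmb constEmb_injective hinvc hinvp hconst hK hgc =
      (ofThetaSettingData μ hC hS h Q R K' constEmb constEmb_injective hinvc hinvp).monoThetaEnvOf
        (facts_ofThetaSettingYddData μ hC hS h Q R K' constEmb constEmb_injective hinvc hinvp hconst hgc)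
        (dkOfThetaSettingData μ hC hS h Q R K' constEmb constEmb_injective hinvc hinvp hconst hK) := rfl

end Setting

end ThetaFrobenioid

end Literature.AnabelianGeometry.EtaleTheta

end
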